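import Mathlib
import Literature.NumberTheory.LFunctions.Zhang2022.AppendixAKappa2PrimePowers
import Literature.NumberTheory.LFunctions.Zhang2022.TypedSection17Identities
import HarnessLib

/-!
# Zhang (2022) §17.u021 (χ-twisted reading), remainder `R₁` (the `m₂ ≥ 2` terms): the EXACT gain
# carried by `κ̄₂(m₁m₂)` — `‖κ₂(mr)‖ = ‖κ₂(m)‖·∏_{q∣r, q∤m}‖q^{−ib₁} − 1‖`

Topic `Literature/NumberTheory/LFunctions/Zhang2022` (Landau–Siegel audit tree; verdict-neutral).
Y. Zhang, *Discrete mean estimates and the Landau–Siegel zero*, arXiv:2211.02515v1 (2022)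
[Zhang2022LandauSiegel] — **an unrefereed manuscript under adjudication; nothing here asserts or denies
its Theorems 1–2.** Lane ZHANG-L, WP16, helper under the leaf `Typed.Section17.Eq17_9Rel`, node
`Typed.Section17.Step17_u021Chi` — reduced by `Section17U021ChiDecomposition.step17_u021Chi_of_remainders`
to `R₁ = o(1)` (terms `m₂ ≥ 2`) and `R₂ = o(1)` (`Section17U021ChiRemainderR2`, landed). §17 p. 98
(tex L4825): "we can drop the terms with `m₂ > 1` … with an acceptable error" — no bound in print.

The one source of smallness in `R₁` is the factor `κ̄₂(m₁m₂)` (`κ₂ = n^{−β₁} ∗ μ`, `|κ₂(q^k)| =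
|q^{−ib₁} − 1| ≤ |b₁|log q` for every `k ≥ 1`, App. A p. 105). This file records it EXACTLY and in the
two forms the `R₁` estimate consumes (both the absolute and the multiplicative route):

* `norm_kappa₂_eq_prod_primeFactors` — `‖κ₂(n)‖ = ∏_{q∣n}‖q^{−ib₁} − 1‖` (`n ≥ 1`): the norm of `κ₂`
  depends only on the RADICAL of `n`;
* `norm_kappa₂_mul_eq` — `‖κ₂(mr)‖ = ‖κ₂(m)‖·∏_{q∣r, q∤m}‖q^{−ib₁} − 1‖`;
* `norm_kappa₂_mul_eq_of_subset` — if every prime of `r` divides `m`, `‖κ₂(mr)‖ = ‖κ₂(m)‖` (no gain —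
  the case that must be won on the `m₁`-side, by the small prime shared with `m₂`);
* `norm_kappa₂_mul_le_of_prime` — if a prime `q ∣ r`, `q ∤ m`, and all primes `q'` of `r` have
  `|b₁|log q' ≤ 1`, then `‖κ₂(mr)‖ ≤ |b₁|log q · ‖κ₂(m)‖` (the gain `≍ α log(T⁵) ≍ 𝓛^{−7.9}`);
* `norm_kappa2bar_eq` — `‖κ̄₂(n)‖ = ‖κ₂^{(b₁)}(n)‖` for the skeleton's `kappa2bar`.

Theorems only; no definitions; nothing about u021/u024, Theorems 1–2 or Landau–Siegel zeros is asserted.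

## References

* Y. Zhang, arXiv:2211.02515v1 (2022), §17 p. 98 (u021, tex L4825); App. A p. 105 (`κ₂(q^r)`).
  [cite: Zhang2022LandauSiegel, §17 u021 p.98]
-/

noncomputable section

open Complex Real ComplexConjugate ArithmeticFunction Finset

namespace Literature.NumberTheory.LFunctions.Zhang2022.Typed.Section17

open Literature.NumberTheory.LFunctions.Zhang2022
open Literature.NumberTheory.LFunctions.Zhang2022.Skeleton
open Literature.NumberTheory.LFunctions.Zhang2022.MeanSquareMajorant (kappa₂ powI isMultiplicative_kappa₂)

/-- **`‖κ₂(n)‖ = ∏_{q∣n}‖q^{−ib₁} − 1‖`** for `n ≥ 1`: `κ₂` is multiplicative and `‖κ₂(q^k)‖ =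
‖q^{−ib₁} − 1‖` for every `k ≥ 1` (App. A p. 105), so the norm sees only the radical of `n`.
[cite: Zhang2022LandauSiegel, App. A p. 105] -/
theorem norm_kappa₂_eq_prod_primeFactors (b : ℝ) {n : ℕ} (hn : n ≠ 0) :
    ‖kappa₂ b n‖ = ∏ q ∈ n.primeFactors, ‖powI b q - 1‖ := by
  rw [ArithmeticFunction.IsMultiplicative.multiplicative_factorization (kappa₂ b)
    (isMultiplicative_kappa₂ b) hn, Nat.prod_factorization_eq_prod_primeFactors, norm_prod]
  refine Finset.prod_congr rfl fun q hq => ?_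
  have hqp : q.Prime := Nat.prime_of_mem_primeFactors hq
  have hk : 0 < n.factorization q := Nat.Prime.factorization_pos_of_dvd hqp hn (Nat.dvd_of_mem_primeFactors hq)
  obtain ⟨j, hj⟩ : ∃ j, n.factorization q = j + 1 := ⟨n.factorization q - 1, by omega⟩
  rw [hj, AppendixA.norm_kappa₂_prime_pow_succ b hqp j]

/-- **The exact gain**: `‖κ₂(mr)‖ = ‖κ₂(m)‖·∏_{q∣r, q∤m}‖q^{−ib₁} − 1‖` (`m, r ≥ 1`).
[cite: Zhang2022LandauSiegel, §17 u021 p.98; App. A p. 105] -/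
theorem norm_kappa₂_mul_eq (b : ℝ) {m r : ℕ} (hm : m ≠ 0) (hr : r ≠ 0) :
    ‖kappa₂ b (m * r)‖ = ‖kappa₂ b m‖ * ∏ q ∈ r.primeFactors \ m.primeFactors, ‖powI b q - 1‖ := by
  rw [norm_kappa₂_eq_prod_primeFactors b (mul_ne_zero hm hr), norm_kappa₂_eq_prod_primeFactors b hm,
    Nat.primeFactors_mul hm hr, ← Finset.prod_union Finset.disjoint_sdiff,
    Finset.union_sdiff_self_eq_union]

/-- No gain when `r` brings no new prime: if every prime factor of `r` divides `m` then
`‖κ₂(mr)‖ = ‖κ₂(m)‖`. [cite: Zhang2022LandauSiegel, §17 u021 p.98] -/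
theorem norm_kappa₂_mul_eq_of_subset (b : ℝ) {m r : ℕ} (hm : m ≠ 0) (hr : r ≠ 0)
    (h : r.primeFactors ⊆ m.primeFactors) : ‖kappa₂ b (m * r)‖ = ‖kappa₂ b m‖ := by
  rw [norm_kappa₂_mul_eq b hm hr, Finset.sdiff_eq_empty_iff_subset.mpr h, Finset.prod_empty, mul_one]

/-- **The gain at a new prime**: if a prime `q` divides `r` but not `m`, and every prime factor `q'` of
`r` satisfies `|b|·log q' ≤ 1` (in the chain: `q' < T⁵`, `|b₁|log T⁵ ≍ 𝓛^{−7.9}`), then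
`‖κ₂(mr)‖ ≤ |b|·log q · ‖κ₂(m)‖`. [cite: Zhang2022LandauSiegel, §17 u021 p.98; App. A p. 105] -/
theorem norm_kappa₂_mul_le_of_prime (b : ℝ) {m r q : ℕ} (hm : m ≠ 0) (hr : r ≠ 0)
    (hq : q ∈ r.primeFactors) (hqm : ¬ q ∣ m) (hsmall : ∀ q' ∈ r.primeFactors, |b| * Real.log q' ≤ 1) :
    ‖kappa₂ b (m * r)‖ ≤ |b| * Real.log q * ‖kappa₂ b m‖ := by
  rw [norm_kappa₂_mul_eq b hm hr, mul_comm]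
  refine mul_le_mul_of_nonneg_right ?_ (norm_nonneg _)
  have hqS : q ∈ r.primeFactors \ m.primeFactors := by
    rw [Finset.mem_sdiff]
    refine ⟨hq, fun h => hqm (Nat.dvd_of_mem_primeFactors h)⟩
  rw [← Finset.mul_prod_erase _ _ hqS]
  have hqp : q.Prime := Nat.prime_of_mem_primeFactors hq
  have h1 : ‖powI b q - 1‖ ≤ |b| * Real.log q := MeanSquareMajorant.norm_powI_sub_one_le b hqp.pos
  have h2 : ∏ x ∈ (r.primeFactors \ m.primeFactors).erase q, ‖powI b x - 1‖ ≤ 1 := by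
    refine Finset.prod_le_one (fun _ _ => norm_nonneg _) fun x hx => ?_
    have hx' : x ∈ r.primeFactors := (Finset.mem_sdiff.mp (Finset.mem_of_mem_erase hx)).1
    exact (MeanSquareMajorant.norm_powI_sub_one_le b (Nat.prime_of_mem_primeFactors hx').pos).trans (hsmall x hx')
  calc ‖powI b q - 1‖ * ∏ x ∈ (r.primeFactors \ m.primeFactors).erase q, ‖powI b x - 1‖
      ≤ (|b| * Real.log q) * 1 :=
        mul_le_mul h1 h2 (Finset.prod_nonneg fun _ _ => norm_nonneg _) (by positivity)
    _ = |b| * Real.log q := mul_one _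

/-- `‖κ̄₂(n)‖ = ‖κ₂^{(b₁)}(n)‖` for the skeleton's `κ̄₂ = conj κ₂` (§17 p. 97).
[cite: Zhang2022LandauSiegel, §17 u016 p.97] -/
theorem norm_kappa2bar_eq (c' : ℝ) (D n : ℕ) : ‖kappa2bar c' D n‖ = ‖kappa₂ (b1 c' D) n‖ := by
  rw [kappa2bar, RCLike.norm_conj]

/-- **The gain for `κ̄₂` in the chain's variables**: for `m₁ ≥ 1`, `m₂ ≥ 1` with a prime `p ∣ m₂`,
`p ∤ m₁`, all prime factors of `m₂` below the level where `|b₁|log ≤ 1`: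
`‖κ̄₂(m₁m₂)‖ ≤ |b₁|·log p·‖κ̄₂(m₁)‖`; and `‖κ̄₂(m₁m₂)‖ = ‖κ̄₂(m₁)‖` when `rad m₂ ∣ m₁`.
[cite: Zhang2022LandauSiegel, §17 u021 p.98] -/
theorem norm_kappa2bar_mul_le_of_prime (c' : ℝ) (D : ℕ) {m₁ m₂ p : ℕ} (hm₁ : m₁ ≠ 0) (hm₂ : m₂ ≠ 0)
    (hp : p ∈ m₂.primeFactors) (hpm : ¬ p ∣ m₁)
    (hsmall : ∀ q ∈ m₂.primeFactors, |b1 c' D| * Real.log q ≤ 1) :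
    ‖kappa2bar c' D (m₁ * m₂)‖ ≤ |b1 c' D| * Real.log p * ‖kappa2bar c' D m₁‖ := by
  rw [norm_kappa2bar_eq, norm_kappa2bar_eq]
  exact norm_kappa₂_mul_le_of_prime (b1 c' D) hm₁ hm₂ hp hpm hsmall

/-- Companion: `‖κ̄₂(m₁m₂)‖ = ‖κ̄₂(m₁)‖` when every prime of `m₂` divides `m₁`.
[cite: Zhang2022LandauSiegel, §17 u021 p.98] -/
theorem norm_kappa2bar_mul_eq_of_subset (c' : ℝ) (D : ℕ) {m₁ m₂ : ℕ} (hm₁ : m₁ ≠ 0) (hm₂ : m₂ ≠ 0)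
    (h : m₂.primeFactors ⊆ m₁.primeFactors) :
    ‖kappa2bar c' D (m₁ * m₂)‖ = ‖kappa2bar c' D m₁‖ := by
  rw [norm_kappa2bar_eq, norm_kappa2bar_eq]
  exact norm_kappa₂_mul_eq_of_subset (b1 c' D) hm₁ hm₂ h

/-- **No new small prime can increase `‖κ₂‖`**: if every prime factor `q` of `r` has `|b|·log q ≤ 1`
then `‖κ₂(mr)‖ ≤ ‖κ₂(m)‖` (all the new factors `‖q^{−ib}−1‖` are `≤ 1`). The case `p₀ ∣ m₁` of the
`R₁` estimate uses this form. [cite: Zhang2022LandauSiegel, §17 u021 p.98; App. A p. 105] -/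
theorem norm_kappa₂_mul_le_self (b : ℝ) {m r : ℕ} (hm : m ≠ 0) (hr : r ≠ 0)
    (hsmall : ∀ q ∈ r.primeFactors, |b| * Real.log q ≤ 1) :
    ‖kappa₂ b (m * r)‖ ≤ ‖kappa₂ b m‖ := by
  rw [norm_kappa₂_mul_eq b hm hr]
  refine mul_le_of_le_one_right (norm_nonneg _) ?_
  refine Finset.prod_le_one (fun _ _ => norm_nonneg _) fun x hx => ?_
  have hx' : x ∈ r.primeFactors := (Finset.mem_sdiff.mp hx).1
  exact (MeanSquareMajorant.norm_powI_sub_one_le b (Nat.prime_of_mem_primeFactors hx').pos).trans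
    (hsmall x hx')

/-- `κ̄₂` form of `norm_kappa₂_mul_le_self`. [cite: Zhang2022LandauSiegel, §17 u021 p.98] -/
theorem norm_kappa2bar_mul_le_self (c' : ℝ) (D : ℕ) {m₁ m₂ : ℕ} (hm₁ : m₁ ≠ 0) (hm₂ : m₂ ≠ 0)
    (hsmall : ∀ q ∈ m₂.primeFactors, |b1 c' D| * Real.log q ≤ 1) :
    ‖kappa2bar c' D (m₁ * m₂)‖ ≤ ‖kappa2bar c' D m₁‖ := by
  rw [norm_kappa2bar_eq, norm_kappa2bar_eq]
  exact norm_kappa₂_mul_le_self (b1 c' D) hm₁ hm₂ hsmall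

/-- **The dichotomy at the least prime of `m₂`**, as used by the `R₁` bound: for `m₁, m₂ ≥ 1`, a prime
`p ∣ m₂`, and all prime factors of `m₂` below the `|b₁|log ≤ 1` level, EITHER `p ∤ m₁` and
`‖κ̄₂(m₁m₂)‖ ≤ |b₁|log p·‖κ̄₂(m₁)‖`, OR `p ∣ m₁` and `‖κ̄₂(m₁m₂)‖ ≤ ‖κ̄₂(m₁)‖`.
[cite: Zhang2022LandauSiegel, §17 u021 p.98] -/
theorem norm_kappa2bar_mul_dichotomy (c' : ℝ) (D : ℕ) {m₁ m₂ p : ℕ} (hm₁ : m₁ ≠ 0) (hm₂ : m₂ ≠ 0)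
    (hp : p ∈ m₂.primeFactors) (hsmall : ∀ q ∈ m₂.primeFactors, |b1 c' D| * Real.log q ≤ 1) :
    (¬ p ∣ m₁ ∧ ‖kappa2bar c' D (m₁ * m₂)‖ ≤ |b1 c' D| * Real.log p * ‖kappa2bar c' D m₁‖) ∨
      (p ∣ m₁ ∧ ‖kappa2bar c' D (m₁ * m₂)‖ ≤ ‖kappa2bar c' D m₁‖) := by
  by_cases h : p ∣ m₁
  · exact Or.inr ⟨h, norm_kappa2bar_mul_le_self c' D hm₁ hm₂ hsmall⟩
  · exact Or.inl ⟨h, norm_kappa2bar_mul_le_of_prime c' D hm₁ hm₂ hp h hsmall⟩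

/-- **Where the beyond-`D⁴` defect of `ν₁*` comes from.** With `W = nN_{β₂} ∗ nN_{β₃}`, for every `n`:
`ν₁*(n) = (υ ∗ W)(n) − Σ_{k∣n, k>D⁴} υ(k)W(n/k)` — the truncation `υ·[≤D⁴]` differs from `υ` only through
the divisors `k > D⁴` of `n` (so `ν₁* = υ∗W` on `n ≤ D⁴`, and for `n > D⁴` the cancellation
`υ∗1∗1 = μχ∗1` is lost exactly by this tail). [cite: Zhang2022LandauSiegel, §17 u021 p.98] -/
theorem nuOneStar_eq_conv_sub_tail (c' : ℝ) {D : ℕ} (χ : DirichletCharacter ℂ D) (n : ℕ) :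
    nuOneStar c' χ n =
      LSeries.convolution (ups χ)
          (LSeries.convolution (nN D (beta2 c' D)) (nN D (beta3 c' D))) n -
        ∑ k ∈ n.divisors with D ^ 4 < k,
          ups χ k * LSeries.convolution (nN D (beta2 c' D)) (nN D (beta3 c' D)) (n / k) := by
  classical
  set W : ℕ → ℂ := LSeries.convolution (nN D (beta2 c' D)) (nN D (beta3 c' D)) with hW
  -- associativity: `ν₁* = (υ·[≤D⁴]) ∗ W`
  have hassoc : nuOneStar c' χ n = LSeries.convolution (trunc (D ^ 4) (ups χ)) W n := by
    simp only [nuOneStar, hW, LSeries.convolution, ArithmeticFunction.toArithmeticFunction_eq_self,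
      mul_assoc]
  rw [hassoc, LSeries.convolution_def, LSeries.convolution_def]
  dsimp only
  rw [Nat.sum_divisorsAntidiagonal (f := fun a b => trunc (D ^ 4) (ups χ) a * W b),
    Nat.sum_divisorsAntidiagonal (f := fun a b => ups χ a * W b), Finset.sum_filter,
    ← Finset.sum_sub_distrib]
  refine Finset.sum_congr rfl fun k _ => ?_
  by_cases hk : D ^ 4 < k
  · simp [trunc, hk, not_le.mpr hk]
  · simp [trunc, hk, not_lt.mp hk]

end Literature.NumberTheory.LFunctions.Zhang2022.Typed.Section17
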